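import Literature.Barriers.SmoothPoincare4.ExoticContractible
import HarnessLib

/-!
# Proof architecture of `ContractibleBarrierFour`: Thm. B from Thm. A, a cork, and Freedman

Sibling proof file of `Literature/Barriers/SmoothPoincare4/ExoticContractible.lean` (D-0021
barrier `Literature.Barriers.ContractibleBarrierFour := ¬ ContractibleRigidityFour`, proved there from
the named fact `akbulutRuberman2016_theoremB`). The discharge `ContractibleBarrierFour_holds`
amounts to the existence of an absolutely exotic pair of compact contractible smooth 4-manifolds
(Akbulut–Ruberman 2016, Thm. B), whose printed proof (§3 there) is one
paragraph: "Apply Theorem A to `(W, τ)`, a cork ... This gives a pair of non-diffeomorphic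
manifolds `V` and `V′` with the same boundary (contractible ...). But Freedman's theorem says that
`V` and `V′` are in fact homeomorphic, so they can be viewed as (absolutely) exotic pairs."
This file vendors the two ingredients of that paragraph which the tree lacks, as named facts
(D-0014), and PROVES Thm. B — hence the barrier — from them and the cork fact
`akbulut1991_mazurCork` already in the tree:

* `akbulutRuberman2016_theoremA_contractible` — Thm. A of loc. cit. in the case of a
  contractible `W` (the case applied in the proof of Thm. B): a boundary diffeomorphism of a
  compact contractible smooth 4-manifold `W` that extends to a self-homeomorphism but to no
  self-diffeomorphism yields compact contractible smooth `V`, `V′` with `∂V ≅ ∂V′` and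
  `V ≇ V′`. Its printed proof (§§2–3: invertible homology cobordisms from doubly slice knots,
  hyperbolic 3-manifolds with computer-certified trivial symmetry group, JSJ/Waldhausen, the
  relative-to-absolute Lemma of §1.1) is a theory of its own and is not attempted.
* `freedmanQuinn1990_homeomorph_extends_contractible` — "Freedman's theorem" as used there:
  every homeomorphism between the boundaries of two compact contractible 4-manifolds extends to a
  homeomorphism between them (Freedman–Quinn 1990, Prop. 11.1C for the trivial group: a homology
  3-sphere bounds a contractible 4-manifold — Cor. 9.3C — "uniquely up to [equivariant]
  homeomorphism", the proof giving a "homeomorphism rel `M`"; the boundary of a compact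
  contractible 4-manifold is an integral homology 3-sphere by Poincaré–Lefschetz duality).
* `akbulutRuberman2016_theoremB_of_theoremA` — Thm. B from the three facts (the printed proof);
  `contractibleBarrierFour_of_theoremA` — the barrier from the three facts;
  `extendsToHomeomorph_of_freedmanQuinn` — the corollary that EVERY boundary diffeomorphism of
  a compact contractible smooth 4-manifold extends to a self-homeomorphism (the clause of
  `Literature.Topology.FourManifolds.IsLooseCork` that `Corks.lean` calls "redundant in truth").

Resulting dependency graph of the barrier (all arrows proved in the tree):
`ContractibleBarrierFour ⇐ akbulutRuberman2016_theoremB ⇐ akbulut1991_mazurCork ∧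
akbulutRuberman2016_theoremA_contractible ∧ freedmanQuinn1990_homeomorph_extends_contractible`,
and `akbulut1991_mazurCork ⇐ ∃ cork (Literature.IsCork)` (`akbulut1991_mazurCork_of_isCork`). The three
leaves (gauge theory; Thm. A; the disc embedding theorem) are named facts.

For the RELATIVE barrier of the sibling file the relation is closed up to an equivalence (last
section): `relativeContractibleBarrierFour_iff_mazurCork :
RelativeContractibleBarrierFour ↔ akbulut1991_mazurCork` and
`relativeContractibleRigidityFour_iff_not_mazurCork :
RelativeContractibleRigidityFour ↔ ¬ akbulut1991_mazurCork`. Consequently the master statement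
`RelativeContractibleRigidityFour` is not a dischargeable fact — a proof of it would be a
disproof of Akbulut's cork (Akbulut 1991, Thm. 2) as rendered in the tree; with Freedman–Quinn
it is exactly the hypothesis of Akbulut–Ruberman's Lemma 1.2 ("every self-diffeomorphism of
`∂W` extends to a diffeomorphism of `W`") asserted for every compact contractible `W`
(`extendsToDiffeomorph_of_relativeContractibleRigidityFour`,
`relativeContractibleRigidityFour_of_forall_extendsToDiffeomorph`), hence "no corks"
(`not_isCork_of_relativeContractibleRigidityFour`).

The historical proof of the cork fact itself (hence of the relative barrier) has two printed
halves, separated in the last section of this file: the SMOOTH half — Akbulut 1991, Thm. 2 (=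
Akbulut–Yasui 2008, Lemma 2.8 (1) for `n = 1`): the dot/zero-exchange involution of the boundary
of the Mazur manifold extends to no self-diffeomorphism — vendored as the named fact
`akbulut1991_notExtendsToDiffeomorph` (existential, with involutivity; gauge theory, not
attempted), and the TOPOLOGICAL half — the involution extends to a self-homeomorphism
(Akbulut–Yasui 2008, Lemma 2.7 (1): "immediate since the boundary of `W_n` is a homology sphere
and `W_n` is contractible"), which is `extendsToHomeomorph_of_freedmanQuinn` here. From the two
leaves, at every universe: a cork in the tree's sense (`exists_isCork_of_akbulut1991`, the proof
of Akbulut–Yasui's Thm. 2.5 (1)), the cork fact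
(`akbulut1991_mazurCork_of_notExtendsToDiffeomorph`), the relative barrier
(`relativeContractibleBarrierFour_of_notExtendsToDiffeomorph`) and, with Thm. A, the absolute
barrier (`contractibleBarrierFour_of_notExtendsToDiffeomorph`); conversely every cork witnesses
the smooth leaf (`akbulut1991_notExtendsToDiffeomorph_iff_exists_isCork`). Dependency graph of
the relative barrier after this section (all arrows proved):
`RelativeContractibleBarrierFour ⇔ akbulut1991_mazurCork ⇐ akbulut1991_notExtendsToDiffeomorph ∧
freedmanQuinn1990_homeomorph_extends_contractible` — two leaves, both named facts (Donaldson/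
Seiberg–Witten gauge theory; the disc embedding theorem).

## What is printed

* Akbulut–Ruberman 2016 (arXiv:1410.1461v3 = Comment. Math. Helv. 91), Thm. A (§1): "If `W` is
  a compact smooth 4-manifold and `F : W → W` a homeomorphism whose restriction to `M = ∂W` is
  a diffeomorphism that does not extend to a self diffeomorphism of `W`. Then `W` contains a
  pair of smooth 4-manifolds `V` and `V′` homotopy equivalent to `W` with `∂V ≅ ∂V′`, such that
  `V` and `V′` are not diffeomorphic to each other."; §2: "Form the union `V = W ∪_M X`, where
  `X` is an invertible homology cobordism from `M = ∂W` to some other 3-manifold `N` ...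
  Cutting out the embedded copy of `W` in `V` and regluing via `f` results in a manifold `V′`";
  §3 (proof of Thm. A): "Since `V` and `V′` are simply connected homology balls, they are
  contractible, hence homeomorphic."; Thm. B (§1) and its proof (§3) as quoted above;
  Lemma 1.2 (§1.1): "Suppose that every self-diffeomorphism of `∂W` extends to a
  diffeomorphism of `W`. Then the natural forgetful map from relative to absolute smoothings
  of `W` is a bijection."
* Freedman–Quinn 1990 (Princeton Math. Series 39), Cor. 9.3C (§9.3): "A 3-manifold with the
  homology of `S³` is the boundary of a contractible topological 4-manifold."; Prop. 11.1C
  (§11.1): "A free action of a finite group on a 3-dimensional homology sphere extends,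
  uniquely up to equivariant homeomorphism, to an action on a contractible manifold which is
  free except at one fixed point."; its proof: "For the uniqueness, suppose that `U` is a
  contractible manifold with boundary `M` ... In particular there is a homeomorphism rel `M`
  from `(U − p)/G` to `⋃ Nᵢ`. Taking universal covers and 1-point compactifications gives an
  equivariant homeomorphism from `U` to the manifold `V` constructed above, so `V` is unique."
* Akbulut–Yasui 2008 (arXiv:0806.3010, §2 numbering), Def. 2.3: "Let `f_n : ∂W_n → ∂W_n` ...
  be the obvious involutions obtained by first surgering `S¹ × B³` to `B² × S²` in the interiors
  of `W_n` ..., then surgering the other imbedded `B² × S²` back to `S¹ × B³` (i.e. replacing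
  the dots in Figure 1)"; Remark 2.4: "(1) `W₁` is a Mazur manifold, and `(W₁, f₁)` is equal to
  `(W, f)` in [A1], [AD]. ... (3) `W_n` and `W̄_n` are contractible ... (4) `W_n` (`n ≥ 0`) ...
  are simply connected compact Stein 4-manifolds."; Thm. 2.5: "(1) For `n ≥ 1`, the pairs
  `(W_n, f_n)` and `(W̄_n, f̄_n)` are corks."; Remark 2.6: "(1) In the case of `(W₁, f₁)` this
  theorem was proved by the first author [A1]."; "This theorem clearly follows from the
  following Lemmas 2.7 and 2.8."; Lemma 2.7: "(1) For `n ≥ 1`, the involution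
  `f_n : ∂W_n → ∂W_n` extends to a self homeomorphism of `W_n`." (proof: "immediate since the
  boundary of `W_n` ... is a homology sphere and `W_n` ... is contractible"); Lemma 2.8: "(1)
  ... `W¹_n` and `W²_n` (`n ≥ 1`) are homeomorphic but not diffeomorphic. In particular, the
  involution `f_n : ∂W_n → ∂W_n` cannot extend to any self diffeomorphism of `W_n`."
* Akbulut 1991 (J. Differential Geom. 33), p. 335, as quoted in the barrier file: "Theorem 2.
  `α` is not slice in `W`, in particular `f` does not extend to a self-diffeomorphism of `W`."

## Rendering choices (wording risks for the reviewer)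

* Thm. A is rendered ONLY for contractible `W` (then `M = ∂W` is a homology sphere, so
  connected and orientable as §2.1 of the source requires of `M`), with "homotopy equivalent to
  `W`" rendered as `ContractibleSpace`, and with `V`, `V′` compact Hausdorff second countable (the
  construction `V = W ∪_M X`, `V′ = X ∪_f W` with `X` a compact cobordism; Thm. B as printed calls
  them "compact contractible smooth 4-manifolds"). The clause "`W` contains `V`, `V′`"
  (codimension-0 embeddings obtained from invertibility of `X`) is DROPPED, so the rendered fact is
  weaker than the printed theorem. "`∂V ≅ ∂V′`" is a diffeomorphism of boundary data, "not
  diffeomorphic" is `IsEmpty (V ≃ₘ V′)`, exactly as in `akbulutRuberman2016_theoremB`.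
* Freedman–Quinn 11.1C is rendered for the trivial group only, for compact contractible SMOOTH
  4-manifolds with smooth boundary data (the tree's `BoundaryData` is smooth data; the printed
  statement is about topological manifolds, so the rendering is a special case), in the
  "rel `M`" form: a homeomorphism `φ : ∂V ≃ₜ ∂V′` extends to `Φ : V ≃ₜ V′` with
  `Φ ∘ incl = incl′ ∘ φ`. That `∂V` is an integral homology 3-sphere is not a hypothesis: it holds
  for every compact contractible 4-manifold (Poincaré–Lefschetz duality, folklore), which is how
  Akbulut–Ruberman apply "Freedman's theorem" to `V`, `V′`.

* Akbulut's Thm. 2 / Akbulut–Yasui's Lemma 2.8 (1) is rendered EXISTENTIALLY (some compact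
  Hausdorff second countable contractible smooth 4-manifold `W`, boundary datum `b`, smooth
  involution `τ` of `b.carrier` with `¬ ExtendsToDiffeomorph b τ`): the tree has no handlebody
  vocabulary to name the Mazur manifold `W₁`, and the Stein structure (Remark 2.4 (4)) is dropped,
  as in `Literature.Topology.FourManifolds.IsCork`; involutivity of `τ` IS kept (Def. 2.3 "the
  obvious involutions", Lemma 2.8 (1) "the involution `f_n`"), unlike in `akbulut1991_mazurCork`.
  Weaker than printed.

## References

[AkbulutRuberman2016] [Akbulut1991Fake] [AkbulutYasui2008] [FreedmanQuinn1990] [FreedmanJDG1982]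
-/

noncomputable section

open scoped Manifold ContDiff
open Function

namespace Literature.Barriers.SmoothPoincare4

universe u

/-! ### Named facts: the two ingredients of the proof of Thm. B -/

/-- **Akbulut–Ruberman 2016, Thm. A, for a contractible `W` (named fact).** Let `W` be a compact
(Hausdorff, second countable) contractible smooth 4-manifold with boundary datum `b`, and let
`f` be a self-diffeomorphism of `∂W` that is the restriction of a self-homeomorphism of `W`
(`ExtendsToHomeomorph b f`) but of no self-diffeomorphism of `W` (`¬ ExtendsToDiffeomorph b f`) —
i.e. `(W, f)` is relatively exotic, e.g. a cork. Then there are compact contractible smooth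
4-manifolds `V`, `V′` with diffeomorphic boundaries which are not diffeomorphic ("Theorem A. If
`W` is a compact smooth 4-manifold and `F : W → W` a homeomorphism whose restriction to `M = ∂W`
is a diffeomorphism that does not extend to a self diffeomorphism of `W`. Then `W` contains a pair
of smooth 4-manifolds `V` and `V′` homotopy equivalent to `W` with `∂V ≅ ∂V′`, such that `V` and
`V′` are not diffeomorphic to each other."; in the proof of Thm. B: "Apply Theorem A to `(W, τ)`,
a cork ... This gives a pair of non-diffeomorphic manifolds `V` and `V′` with the same boundary
(contractible ...)"). Rendered for contractible `W` only, "homotopy equivalent to `W`" as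
`ContractibleSpace`, `V`, `V′` compact (they are `W ∪_M X` and `X ∪_f W` for a compact invertible
homology cobordism `X`); the printed clause "`W` contains `V`, `V′`" is dropped (weaker than
printed). Users take `(h : akbulutRuberman2016_theoremA_contractible)`.
[cite: AkbulutRuberman2016, Thm. A and proof of Thm. B (§3)] -/
def akbulutRuberman2016_theoremA_contractible : Prop :=
  ∀ (W : Type u) [TopologicalSpace W] [T2Space W] [SecondCountableTopology W]
    [ChartedSpace (EuclideanHalfSpace 4) W] [IsManifold (𝓡∂ 4) ∞ W] [CompactSpace W]
    [ContractibleSpace W] (b : Literature.Topology.FourManifolds.BoundaryData (𝓡∂ 4) W (𝓡 3))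
    (f : b.carrier ≃ₘ⟮𝓡 3, 𝓡 3⟯ b.carrier),
    Literature.Topology.FourManifolds.ExtendsToHomeomorph b f → ¬ Literature.Topology.FourManifolds.ExtendsToDiffeomorph b f →
    ∃ (V V' : Type u) (_ : TopologicalSpace V) (_ : T2Space V) (_ : SecondCountableTopology V)
      (_ : ChartedSpace (EuclideanHalfSpace 4) V) (_ : IsManifold (𝓡∂ 4) ∞ V) (_ : CompactSpace V)
      (_ : ContractibleSpace V)
      (_ : TopologicalSpace V') (_ : T2Space V') (_ : SecondCountableTopology V')
      (_ : ChartedSpace (EuclideanHalfSpace 4) V') (_ : IsManifold (𝓡∂ 4) ∞ V')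
      (_ : CompactSpace V') (_ : ContractibleSpace V')
      (bV : Literature.Topology.FourManifolds.BoundaryData (𝓡∂ 4) V (𝓡 3)) (bV' : Literature.Topology.FourManifolds.BoundaryData (𝓡∂ 4) V' (𝓡 3)),
      Nonempty (bV.carrier ≃ₘ⟮𝓡 3, 𝓡 3⟯ bV'.carrier) ∧ IsEmpty (V ≃ₘ⟮𝓡∂ 4, 𝓡∂ 4⟯ V')

/-- **Freedman–Quinn 1990, Prop. 11.1C for the trivial group (named fact): a homeomorphism
between the boundaries of two compact contractible 4-manifolds extends to a homeomorphism
between them.** For compact (Hausdorff, second countable) contractible smooth 4-manifolds `V`,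
`V′` with boundary data `b`, `b′` and every homeomorphism `φ : ∂V ≃ₜ ∂V′` there is a homeomorphism
`Φ : V ≃ₜ V′` with `Φ ∘ b.incl = b′.incl ∘ φ`. Source: the boundary of a compact contractible
4-manifold is an integral homology 3-sphere (Poincaré–Lefschetz duality), every homology 3-sphere
`M` bounds a contractible topological 4-manifold (Cor. 9.3C: "A 3-manifold with the homology of
`S³` is the boundary of a contractible topological 4-manifold"), and such a bounding manifold is
unique up to homeomorphism rel `M` (Prop. 11.1C with `G` trivial: "A free action of a finite
group on a 3-dimensional homology sphere extends, uniquely up to equivariant homeomorphism, to an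
action on a contractible manifold ..."; proof: "there is a homeomorphism rel `M` ..."); comparing
`V` (boundary marked by `b.incl`) and `V′` (boundary marked by `b′.incl ∘ φ`) with the same `M = ∂V`
gives `Φ`. This is the "Freedman's theorem says that `V` and `V′` are in fact homeomorphic" of
Akbulut–Ruberman's proof of Thm. B. Rendered for smooth manifolds with smooth boundary data only
(the printed statements are topological; special case). Users take
`(h : freedmanQuinn1990_homeomorph_extends_contractible)`.
[cite: FreedmanQuinn1990, Prop. 11.1C (trivial group) and Cor. 9.3C] [cite: AkbulutRuberman2016, proof of Thm. B] -/
def freedmanQuinn1990_homeomorph_extends_contractible : Prop :=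
  ∀ (V V' : Type u) [TopologicalSpace V] [T2Space V] [SecondCountableTopology V]
    [ChartedSpace (EuclideanHalfSpace 4) V] [IsManifold (𝓡∂ 4) ∞ V] [CompactSpace V]
    [ContractibleSpace V]
    [TopologicalSpace V'] [T2Space V'] [SecondCountableTopology V']
    [ChartedSpace (EuclideanHalfSpace 4) V'] [IsManifold (𝓡∂ 4) ∞ V'] [CompactSpace V']
    [ContractibleSpace V'] (b : Literature.Topology.FourManifolds.BoundaryData (𝓡∂ 4) V (𝓡 3)) (b' : Literature.Topology.FourManifolds.BoundaryData (𝓡∂ 4) V' (𝓡 3))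
    (φ : b.carrier ≃ₜ b'.carrier),
    ∃ Φ : V ≃ₜ V', ∀ x : b.carrier, Φ (b.incl x) = b'.incl (φ x)

/-! ### Consequences of the Freedman–Quinn fact -/

/-- Compact contractible smooth 4-manifolds with homeomorphic boundaries are homeomorphic
(from `freedmanQuinn1990_homeomorph_extends_contractible`, hypothesis `hF`).
[cite: FreedmanQuinn1990, Prop. 11.1C (trivial group) and Cor. 9.3C] -/
theorem nonempty_homeomorph_of_freedmanQuinn
    (hF : freedmanQuinn1990_homeomorph_extends_contractible.{u})
    {V V' : Type u} [TopologicalSpace V] [T2Space V] [SecondCountableTopology V]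
    [ChartedSpace (EuclideanHalfSpace 4) V] [IsManifold (𝓡∂ 4) ∞ V] [CompactSpace V]
    [ContractibleSpace V]
    [TopologicalSpace V'] [T2Space V'] [SecondCountableTopology V']
    [ChartedSpace (EuclideanHalfSpace 4) V'] [IsManifold (𝓡∂ 4) ∞ V'] [CompactSpace V']
    [ContractibleSpace V'] (b : Literature.Topology.FourManifolds.BoundaryData (𝓡∂ 4) V (𝓡 3)) (b' : Literature.Topology.FourManifolds.BoundaryData (𝓡∂ 4) V' (𝓡 3))
    (hφ : Nonempty (b.carrier ≃ₜ b'.carrier)) : Nonempty (V ≃ₜ V') := by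
  obtain ⟨φ⟩ := hφ
  obtain ⟨Φ, -⟩ := hF V V' b b' φ
  exact ⟨Φ⟩

/-- Every self-diffeomorphism (indeed every self-homeomorphism) of the boundary of a compact
contractible smooth 4-manifold `C` extends to a self-homeomorphism of `C` — the clause
`ExtendsToHomeomorph b τ` of `Literature.Topology.FourManifolds.IsLooseCork` / `Literature.Topology.FourManifolds.IsCork` is automatic (from
`freedmanQuinn1990_homeomorph_extends_contractible` with `V = V′ = C`, hypothesis `hF`).
[cite: FreedmanQuinn1990, Prop. 11.1C (trivial group)] [cite: AkbulutRuberman2016, §1] -/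
theorem extendsToHomeomorph_of_freedmanQuinn
    (hF : freedmanQuinn1990_homeomorph_extends_contractible.{u})
    {C : Type u} [TopologicalSpace C] [T2Space C] [SecondCountableTopology C]
    [ChartedSpace (EuclideanHalfSpace 4) C] [IsManifold (𝓡∂ 4) ∞ C] [CompactSpace C]
    [ContractibleSpace C] (b : Literature.Topology.FourManifolds.BoundaryData (𝓡∂ 4) C (𝓡 3))
    (τ : b.carrier ≃ₘ⟮𝓡 3, 𝓡 3⟯ b.carrier) : Literature.Topology.FourManifolds.ExtendsToHomeomorph b τ := by
  obtain ⟨Φ, hΦ⟩ := hF C C b b τ.toHomeomorph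
  exact ⟨Φ, hΦ⟩

/-- With Freedman–Quinn, a cork is just a compact (Hausdorff) contractible smooth 4-manifold with
a boundary involution that extends to no self-diffeomorphism: the homeomorphism clause of
`Literature.Topology.FourManifolds.IsCork` is discharged by `extendsToHomeomorph_of_freedmanQuinn` (hypothesis `hF`).
[cite: FreedmanQuinn1990, Prop. 11.1C (trivial group)] [cite: AkbulutRuberman2016, §1] -/
theorem isCork_of_freedmanQuinn
    (hF : freedmanQuinn1990_homeomorph_extends_contractible.{u})
    {C : Type u} [TopologicalSpace C] [T2Space C] [SecondCountableTopology C]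
    [ChartedSpace (EuclideanHalfSpace 4) C] [IsManifold (𝓡∂ 4) ∞ C] [CompactSpace C]
    [ContractibleSpace C] (b : Literature.Topology.FourManifolds.BoundaryData (𝓡∂ 4) C (𝓡 3))
    (τ : b.carrier ≃ₘ⟮𝓡 3, 𝓡 3⟯ b.carrier) (hτ : Function.Involutive τ)
    (hD : ¬ Literature.Topology.FourManifolds.ExtendsToDiffeomorph b τ) : Literature.Topology.FourManifolds.IsCork b τ :=
  ⟨⟨‹CompactSpace C›, ‹T2Space C›, ‹ContractibleSpace C›, hτ,
    extendsToHomeomorph_of_freedmanQuinn hF b τ⟩, hD⟩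

/-! ### Thm. B and the barrier from Thm. A, a cork, and Freedman–Quinn -/

/-- **Akbulut–Ruberman 2016, Thm. B from its printed proof**: a cork `(W, f)`
(`akbulut1991_mazurCork`, hypothesis `hC`), Thm. A applied to it (hypothesis `hA`) and
Freedman's theorem (hypothesis `hF`) give compact contractible smooth `V`, `V′` with
diffeomorphic boundaries that are homeomorphic but not diffeomorphic ("Apply Theorem A to
`(W, τ)`, a cork ... gives a pair of non-diffeomorphic manifolds `V` and `V′` with the same
boundary ... But Freedman's theorem says that `V` and `V′` are in fact homeomorphic").
[cite: AkbulutRuberman2016, proof of Thm. B (§3)] -/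
theorem akbulutRuberman2016_theoremB_of_theoremA (hC : akbulut1991_mazurCork.{u})
    (hA : akbulutRuberman2016_theoremA_contractible.{u})
    (hF : freedmanQuinn1990_homeomorph_extends_contractible.{u}) :
    akbulutRuberman2016_theoremB.{u} := by
  obtain ⟨W, _, _, _, _, _, _, _, b, f, hH, hD⟩ := hC
  obtain ⟨V, V', _, _, _, _, _, _, _, _, _, _, _, _, _, _, bV, bV', ⟨ψ⟩, hE⟩ := hA W b f hH hD
  exact ⟨V, V', ‹_›, ‹_›, ‹_›, ‹_›, ‹_›, ‹_›, ‹_›, ‹_›, ‹_›, ‹_›, ‹_›, ‹_›, ‹_›, ‹_›, bV, bV', ⟨ψ⟩,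
    nonempty_homeomorph_of_freedmanQuinn hF bV bV' ⟨ψ.toHomeomorph⟩, hE⟩

/-- **`ContractibleBarrierFour` from the leaves of its proof**: a cork (`hC`), Akbulut–Ruberman's
Thm. A for contractible `W` (`hA`) and Freedman–Quinn 11.1C (`hF`); via
`akbulutRuberman2016_theoremB_of_theoremA` and `contractibleBarrierFour_of_akbulutRuberman`.
[cite: AkbulutRuberman2016, Thm. B and its proof (§3)] -/
theorem contractibleBarrierFour_of_theoremA (hC : akbulut1991_mazurCork.{u})
    (hA : akbulutRuberman2016_theoremA_contractible.{u})
    (hF : freedmanQuinn1990_homeomorph_extends_contractible.{u}) :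
    ContractibleBarrierFour.{u} :=
  contractibleBarrierFour_of_akbulutRuberman (akbulutRuberman2016_theoremB_of_theoremA hC hA hF)

/-- The same with the cork supplied in the tree's sense (`Literature.Topology.FourManifolds.IsCork`, any cork on a second
countable `W`), through `akbulut1991_mazurCork_of_isCork`.
[cite: AkbulutRuberman2016, §1 and proof of Thm. B] -/
theorem contractibleBarrierFour_of_isCork
    (h : ∃ (W : Type u) (_ : TopologicalSpace W) (_ : SecondCountableTopology W)
      (_ : ChartedSpace (EuclideanHalfSpace 4) W) (_ : IsManifold (𝓡∂ 4) ∞ W)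
      (b : Literature.Topology.FourManifolds.BoundaryData (𝓡∂ 4) W (𝓡 3)) (τ : b.carrier ≃ₘ⟮𝓡 3, 𝓡 3⟯ b.carrier), Literature.Topology.FourManifolds.IsCork b τ)
    (hA : akbulutRuberman2016_theoremA_contractible.{u})
    (hF : freedmanQuinn1990_homeomorph_extends_contractible.{u}) :
    ContractibleBarrierFour.{u} :=
  contractibleBarrierFour_of_theoremA (akbulut1991_mazurCork_of_isCork h) hA hF

/-! ### The relative barrier: `RelativeContractibleRigidityFour` is the negation of the cork fact

The master statement (a) of the barrier file, `RelativeContractibleRigidityFour` ("every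
boundary diffeomorphism of a compact contractible smooth 4-manifold that extends to a
self-homeomorphism extends to a self-diffeomorphism"), is by `push_neg` exactly the statement
that no pair `(W, f)` as in `akbulut1991_mazurCork` exists. So the barrier
`RelativeContractibleBarrierFour` is *equivalent* to Akbulut's cork fact, and the master
statement is not a dischargeable fact: a proof of it would be a disproof of Akbulut 1991,
Thm. 2 as rendered in the tree ("a cork is a compact smooth contractible manifold `W` together
with a diffeomorphism `f : ∂W → ∂W` which does not extend to a self-diffeomorphism of `W`,
although it does extend to a self-homeomorphism", Akbulut–Ruberman 2016, §1, citing [2] =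
Akbulut 1991). What the source does print positively is the hypothesis of its Lemma 1.2
("Suppose that every self-diffeomorphism of `∂W` extends to a diffeomorphism of `W`. Then the
natural forgetful map from relative to absolute smoothings of `W` is a bijection."), satisfied
"[8] if `W = B⁴` or more generally [23] if `W = ♮ⁿ S¹ × B³`"; with Freedman–Quinn the master
statement says precisely that this hypothesis holds for EVERY compact contractible `W`
(`extendsToDiffeomorph_of_relativeContractibleRigidityFour`), i.e. that there are no corks
(`not_isCork_of_relativeContractibleRigidityFour`). -/

/-- **The relative barrier is equivalent to the cork fact**:
`RelativeContractibleBarrierFour ↔ akbulut1991_mazurCork`. Backward is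
`relativeContractibleBarrierFour_of_akbulut`; forward: if relative rigidity fails, some compact
contractible smooth `W` with boundary datum `b` carries a boundary diffeomorphism `f` extending
to a self-homeomorphism but to no self-diffeomorphism — a witness of the fact (classical
`push_neg`). [cite: Akbulut1991Fake, Thms. 1-2] [cite: AkbulutRuberman2016, §1] -/
theorem relativeContractibleBarrierFour_iff_mazurCork :
    RelativeContractibleBarrierFour.{u} ↔ akbulut1991_mazurCork.{u} := by
  refine ⟨fun h => ?_, relativeContractibleBarrierFour_of_akbulut⟩
  by_contra hA
  refine h fun W _ _ _ _ _ _ _ b f hH => ?_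
  by_contra hD
  exact hA ⟨W, ‹_›, ‹_›, ‹_›, ‹_›, ‹_›, ‹_›, ‹_›, b, f, hH, hD⟩

-- `linter.deprecated` is off for the next declaration only: it must name the master statement
-- (`RelativeContractibleRigidityFour` / `ContractibleRigidityFour`, kept verbatim in `ExoticContractible.lean`
-- but deprecated AS A NAMED FACT, verdict clean-up 2026-08-15) in order to characterise it.
set_option linter.deprecated false in
/-- **The master statement (a) is the negation of the cork fact**:
`RelativeContractibleRigidityFour ↔ ¬ akbulut1991_mazurCork`. In particular
`RelativeContractibleRigidityFour` is refuted, not open, relative to Literature: discharging it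
would disprove Akbulut's Thm. 2 (existence of a cork) as rendered in the tree.
[cite: Akbulut1991Fake, Thm. 2] [cite: AkbulutRuberman2016, §1] -/
theorem relativeContractibleRigidityFour_iff_not_mazurCork :
    RelativeContractibleRigidityFour.{u} ↔ ¬ akbulut1991_mazurCork.{u} := by
  rw [← relativeContractibleBarrierFour_iff_mazurCork, RelativeContractibleBarrierFour, not_not]

-- `linter.deprecated` is off for the next declaration only: it must name the master statement
-- (`RelativeContractibleRigidityFour` / `ContractibleRigidityFour`, kept verbatim in `ExoticContractible.lean`
-- but deprecated AS A NAMED FACT, verdict clean-up 2026-08-15) in order to characterise it.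
set_option linter.deprecated false in
/-- Relative rigidity says there are **no corks** in the tree's sense: under
`RelativeContractibleRigidityFour` (hypothesis `h`), no boundary involution of a (second
countable) compact contractible smooth 4-manifold is a cork (`Literature.IsCork b τ` supplies
compactness, Hausdorffness, contractibility and the homeomorphic extension; `h` then extends `τ`
smoothly, contradicting the cork's non-extension clause). [cite: AkbulutRuberman2016, §1] -/
theorem not_isCork_of_relativeContractibleRigidityFour (h : RelativeContractibleRigidityFour.{u})
    {W : Type u} [TopologicalSpace W] [SecondCountableTopology W]
    [ChartedSpace (EuclideanHalfSpace 4) W] [IsManifold (𝓡∂ 4) ∞ W]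
    (b : Literature.Topology.FourManifolds.BoundaryData (𝓡∂ 4) W (𝓡 3)) (τ : b.carrier ≃ₘ⟮𝓡 3, 𝓡 3⟯ b.carrier) : ¬ Literature.Topology.FourManifolds.IsCork b τ := by
  intro hC
  haveI : CompactSpace W := hC.isLooseCork.compactSpace
  haveI : T2Space W := hC.isLooseCork.2.1
  haveI : ContractibleSpace W := hC.isLooseCork.contractibleSpace
  exact hC.not_extendsToDiffeomorph (h W b τ hC.isLooseCork.2.2.2.2)

-- `linter.deprecated` is off for the next declaration only: it must name the master statement
-- (`RelativeContractibleRigidityFour` / `ContractibleRigidityFour`, kept verbatim in `ExoticContractible.lean`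
-- but deprecated AS A NAMED FACT, verdict clean-up 2026-08-15) in order to characterise it.
set_option linter.deprecated false in
/-- With Freedman–Quinn (hypothesis `hF`: every boundary diffeomorphism of a compact contractible
4-manifold extends to a self-homeomorphism), the master statement (a) (hypothesis `h`) is exactly
the hypothesis of Akbulut–Ruberman's Lemma 1.2 for EVERY compact contractible smooth `W`:
"every self-diffeomorphism of `∂W` extends to a diffeomorphism of `W`" — printed there as
holding for `W = B⁴` [8] and `W = ♮ⁿ S¹ × B³` [23], and failing for corks.
[cite: AkbulutRuberman2016, §1.1 (Lemma 1.2 and the remark after it)] [cite: FreedmanQuinn1990, Prop. 11.1C (trivial group)] -/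
theorem extendsToDiffeomorph_of_relativeContractibleRigidityFour
    (h : RelativeContractibleRigidityFour.{u})
    (hF : freedmanQuinn1990_homeomorph_extends_contractible.{u})
    {W : Type u} [TopologicalSpace W] [T2Space W] [SecondCountableTopology W]
    [ChartedSpace (EuclideanHalfSpace 4) W] [IsManifold (𝓡∂ 4) ∞ W] [CompactSpace W]
    [ContractibleSpace W] (b : Literature.Topology.FourManifolds.BoundaryData (𝓡∂ 4) W (𝓡 3))
    (τ : b.carrier ≃ₘ⟮𝓡 3, 𝓡 3⟯ b.carrier) : Literature.Topology.FourManifolds.ExtendsToDiffeomorph b τ :=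
  h W b τ (extendsToHomeomorph_of_freedmanQuinn hF b τ)

-- `linter.deprecated` is off for the next declaration only: it must name the master statement
-- (`RelativeContractibleRigidityFour` / `ContractibleRigidityFour`, kept verbatim in `ExoticContractible.lean`
-- but deprecated AS A NAMED FACT, verdict clean-up 2026-08-15) in order to characterise it.
set_option linter.deprecated false in
/-- Conversely, if every boundary diffeomorphism of every compact contractible smooth 4-manifold
extends to a self-diffeomorphism (the hypothesis of Lemma 1.2, universally), then relative
rigidity holds trivially. Together with the previous theorem: modulo Freedman–Quinn,
`RelativeContractibleRigidityFour` IS the universal Lemma-1.2 hypothesis.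
[cite: AkbulutRuberman2016, §1.1 (Lemma 1.2)] -/
theorem relativeContractibleRigidityFour_of_forall_extendsToDiffeomorph
    (hE : ∀ (W : Type u) [TopologicalSpace W] [T2Space W] [SecondCountableTopology W]
      [ChartedSpace (EuclideanHalfSpace 4) W] [IsManifold (𝓡∂ 4) ∞ W] [CompactSpace W]
      [ContractibleSpace W] (b : Literature.Topology.FourManifolds.BoundaryData (𝓡∂ 4) W (𝓡 3))
      (τ : b.carrier ≃ₘ⟮𝓡 3, 𝓡 3⟯ b.carrier), Literature.Topology.FourManifolds.ExtendsToDiffeomorph b τ) :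
    RelativeContractibleRigidityFour.{u} :=
  fun W _ _ _ _ _ _ _ b f _ => hE W b f

/-! ### The historical route: Akbulut's smooth leaf and Freedman–Quinn

Akbulut 1991 proved that the Mazur manifold `W` (= `W₁` of Akbulut–Yasui 2008: `S¹ × B³` with
one 2-handle; compact, contractible, Stein) carries a boundary involution `f` (= `f₁`, the
dot/zero exchange on its symmetric link diagram) that extends to no self-diffeomorphism of `W`
(Akbulut 1991, Thm. 2; Akbulut–Yasui 2008, Lemma 2.8 (1) for `n = 1`, Remark 2.6 (1): "In the
case of `(W₁, f₁)` this theorem was proved by the first author [A1]"). That `f` extends to a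
self-homeomorphism is the separate, topological half (Akbulut–Yasui 2008, Lemma 2.7 (1), from
Freedman: "immediate since the boundary of `W_n` is a homology sphere and `W_n` is
contractible"), which in this file is `extendsToHomeomorph_of_freedmanQuinn`. The smooth half is
the named fact below; everything else in this section is assembled from it. -/

/-- **Akbulut 1991, Thm. 2 = Akbulut–Yasui 2008, Lemma 2.8 (1), `n = 1` (named fact): the smooth
half of the Mazur cork.** There are a compact (Hausdorff, second countable) contractible smooth
4-manifold `W` with boundary datum `b` and a smooth involution `τ` of `∂W` that is the
restriction of NO self-diffeomorphism of `W` (`¬ ExtendsToDiffeomorph b τ`). Printed for the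
Mazur manifold `W = W₁` and the dot/zero-exchange involution `τ = f₁` of its boundary:
"Theorem 2. `α` is not slice in `W`, in particular `f` does not extend to a self-diffeomorphism
of `W`." (Akbulut 1991, p. 335); "Let `f_n : ∂W_n → ∂W_n` ... be the obvious involutions ...",
"`W₁` is a Mazur manifold, and `(W₁, f₁)` is equal to `(W, f)` in [A1]", "`W_n` and `W̄_n` are
contractible", "simply connected compact Stein 4-manifolds", "In particular, the involution
`f_n : ∂W_n → ∂W_n` cannot extend to any self diffeomorphism of `W_n`." (`n ≥ 1`; Akbulut–Yasui
2008, Def. 2.3, Remark 2.4 (1), (3), (4), Lemma 2.8 (1)). Rendered existentially, without the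
Stein structure and without naming `W₁` (no handlebody vocabulary in the tree) — weaker than
printed; involutivity is kept. The printed proofs are gauge-theoretic and are not attempted
(Akbulut 1991: see the `because:` line of `RelativeContractibleBarrierFour`; Akbulut–Yasui 2008,
proof of Lemma 2.8: "every compact Stein manifold can be embedded into a minimal symplectic
4-manifold", so the Stein manifold `W¹_n ⊃ W_n` "has no 2-sphere with self intersection number
`-1`. But clearly `W²_n`", its twist along `f_n`, "contains a 2-sphere with self intersection
number `-1`"). Users take `(h : akbulut1991_notExtendsToDiffeomorph)`.
[cite: Akbulut1991Fake, Thm. 2] [cite: AkbulutYasui2008, Lemma 2.8 (1), Def. 2.3 and Remark 2.4 (arXiv:0806.3010 §2 numbering)] -/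
def akbulut1991_notExtendsToDiffeomorph : Prop :=
  ∃ (W : Type u) (_ : TopologicalSpace W) (_ : T2Space W) (_ : SecondCountableTopology W)
    (_ : ChartedSpace (EuclideanHalfSpace 4) W) (_ : IsManifold (𝓡∂ 4) ∞ W) (_ : CompactSpace W)
    (_ : ContractibleSpace W) (b : Literature.Topology.FourManifolds.BoundaryData (𝓡∂ 4) W (𝓡 3))
    (τ : b.carrier ≃ₘ⟮𝓡 3, 𝓡 3⟯ b.carrier),
    Function.Involutive τ ∧ ¬ Literature.Topology.FourManifolds.ExtendsToDiffeomorph b τ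

/-- **A cork exists (Akbulut–Yasui 2008, Thm. 2.5 (1) for `n = 1`), from the smooth leaf and
Freedman–Quinn.** The smooth half (`hA`: a boundary involution of a compact contractible smooth
4-manifold extending to no self-diffeomorphism) and the topological half (`hF`, through
`isCork_of_freedmanQuinn`: it extends to a self-homeomorphism) give a cork in the tree's sense
(`Literature.Topology.FourManifolds.IsCork`) on a second countable `W` — "This theorem clearly
follows from the following Lemmas 2.7 and 2.8." [cite: AkbulutYasui2008, Thm. 2.5 (1), Lemmas 2.7 (1) and 2.8 (1) (arXiv:0806.3010 §2 numbering)] [cite: FreedmanQuinn1990, Prop. 11.1C (trivial group)] -/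
theorem exists_isCork_of_akbulut1991 (hA : akbulut1991_notExtendsToDiffeomorph.{u})
    (hF : freedmanQuinn1990_homeomorph_extends_contractible.{u}) :
    ∃ (W : Type u) (_ : TopologicalSpace W) (_ : SecondCountableTopology W)
      (_ : ChartedSpace (EuclideanHalfSpace 4) W) (_ : IsManifold (𝓡∂ 4) ∞ W)
      (b : Literature.Topology.FourManifolds.BoundaryData (𝓡∂ 4) W (𝓡 3))
      (τ : b.carrier ≃ₘ⟮𝓡 3, 𝓡 3⟯ b.carrier), Literature.Topology.FourManifolds.IsCork b τ := by
  obtain ⟨W, _, _, _, _, _, _, _, b, τ, hτ, hD⟩ := hA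
  exact ⟨W, ‹_›, ‹_›, ‹_›, ‹_›, b, τ, isCork_of_freedmanQuinn hF b τ hτ hD⟩

/-- Conversely, **every cork witnesses the smooth leaf**: a cork in the tree's sense (on a second
countable `W`) is compact, Hausdorff and contractible with an involutive boundary map extending
to no self-diffeomorphism (`Literature.Topology.FourManifolds.IsCork`, Akbulut–Yasui 2008,
Def. 2.1). [cite: AkbulutYasui2008, Def. 2.1 (arXiv:0806.3010 §2 numbering)] -/
theorem akbulut1991_notExtendsToDiffeomorph_of_isCork
    (h : ∃ (W : Type u) (_ : TopologicalSpace W) (_ : SecondCountableTopology W)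
      (_ : ChartedSpace (EuclideanHalfSpace 4) W) (_ : IsManifold (𝓡∂ 4) ∞ W)
      (b : Literature.Topology.FourManifolds.BoundaryData (𝓡∂ 4) W (𝓡 3))
      (τ : b.carrier ≃ₘ⟮𝓡 3, 𝓡 3⟯ b.carrier), Literature.Topology.FourManifolds.IsCork b τ) :
    akbulut1991_notExtendsToDiffeomorph.{u} := by
  obtain ⟨W, _, _, _, _, b, τ, hC⟩ := h
  haveI : CompactSpace W := hC.isLooseCork.compactSpace
  haveI : T2Space W := hC.isLooseCork.2.1
  haveI : ContractibleSpace W := hC.isLooseCork.contractibleSpace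
  exact ⟨W, ‹_›, ‹_›, ‹_›, ‹_›, ‹_›, ‹_›, ‹_›, b, τ, hC.isLooseCork.involutive,
    hC.not_extendsToDiffeomorph⟩

/-- **Modulo Freedman–Quinn, the smooth leaf IS the existence of a cork** (tree's sense, second
countable carrier): `akbulut1991_notExtendsToDiffeomorph ↔ ∃ cork`, under `hF`.
[cite: AkbulutYasui2008, Thm. 2.5 (1) and Def. 2.1 (arXiv:0806.3010 §2 numbering)] [cite: FreedmanQuinn1990, Prop. 11.1C (trivial group)] -/
theorem akbulut1991_notExtendsToDiffeomorph_iff_exists_isCork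
    (hF : freedmanQuinn1990_homeomorph_extends_contractible.{u}) :
    akbulut1991_notExtendsToDiffeomorph.{u} ↔
      ∃ (W : Type u) (_ : TopologicalSpace W) (_ : SecondCountableTopology W)
        (_ : ChartedSpace (EuclideanHalfSpace 4) W) (_ : IsManifold (𝓡∂ 4) ∞ W)
        (b : Literature.Topology.FourManifolds.BoundaryData (𝓡∂ 4) W (𝓡 3))
        (τ : b.carrier ≃ₘ⟮𝓡 3, 𝓡 3⟯ b.carrier), Literature.Topology.FourManifolds.IsCork b τ :=
  ⟨fun hA => exists_isCork_of_akbulut1991 hA hF, akbulut1991_notExtendsToDiffeomorph_of_isCork⟩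

/-- **The cork fact from its two printed halves**: `akbulut1991_mazurCork` (Akbulut 1991,
Thms. 1-2: `f` "extends to a homeomorphism `F : W → W`" by [9] = Freedman, and "does not extend
to a self-diffeomorphism of `W`") from the smooth leaf (`hA`) and Freedman–Quinn (`hF`), through
`exists_isCork_of_akbulut1991` and `akbulut1991_mazurCork_of_isCork`.
[cite: Akbulut1991Fake, Thm. 2 and p. 335] [cite: FreedmanQuinn1990, Prop. 11.1C (trivial group)] -/
theorem akbulut1991_mazurCork_of_notExtendsToDiffeomorph
    (hA : akbulut1991_notExtendsToDiffeomorph.{u})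
    (hF : freedmanQuinn1990_homeomorph_extends_contractible.{u}) :
    akbulut1991_mazurCork.{u} :=
  akbulut1991_mazurCork_of_isCork (exists_isCork_of_akbulut1991 hA hF)

/-- **`RelativeContractibleBarrierFour` at every universe from the two leaves of its historical
proof**: Akbulut's Thm. 2 (`hA`, gauge theory) and Freedman–Quinn 11.1C (`hF`, the disc
embedding theorem), through `akbulut1991_mazurCork_of_notExtendsToDiffeomorph` and
`relativeContractibleBarrierFour_of_akbulut`. The discharge of the barrier is thereby reduced to
the discharge of these two named facts (compare `relativeContractibleBarrierFour_of_corkTheorem`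
in `ExoticContractibleCorkTheoremProofs.lean`: four tree facts, universe `0`).
[cite: Akbulut1991Fake, Thms. 1-2] [cite: AkbulutRuberman2016, §1] -/
theorem relativeContractibleBarrierFour_of_notExtendsToDiffeomorph
    (hA : akbulut1991_notExtendsToDiffeomorph.{u})
    (hF : freedmanQuinn1990_homeomorph_extends_contractible.{u}) :
    RelativeContractibleBarrierFour.{u} :=
  relativeContractibleBarrierFour_of_akbulut (akbulut1991_mazurCork_of_notExtendsToDiffeomorph hA hF)

/-- **`ContractibleBarrierFour` at every universe from three leaves**: Akbulut's Thm. 2 (`hA`),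
Akbulut–Ruberman's Thm. A for contractible `W` (`hT`) and Freedman–Quinn (`hF`), through
`akbulut1991_mazurCork_of_notExtendsToDiffeomorph` and `contractibleBarrierFour_of_theoremA`.
[cite: AkbulutRuberman2016, Thm. B and its proof (§3)] [cite: Akbulut1991Fake, Thm. 2] -/
theorem contractibleBarrierFour_of_notExtendsToDiffeomorph
    (hA : akbulut1991_notExtendsToDiffeomorph.{u})
    (hT : akbulutRuberman2016_theoremA_contractible.{u})
    (hF : freedmanQuinn1990_homeomorph_extends_contractible.{u}) :
    ContractibleBarrierFour.{u} :=
  contractibleBarrierFour_of_theoremA (akbulut1991_mazurCork_of_notExtendsToDiffeomorph hA hF) hT hF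

end Literature.Barriers.SmoothPoincare4

end
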